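import Summits.CriticalPhenomena.PercolationContinuityZ3.Theorems.Transplant.HexShadowVRouting
import Summits.CriticalPhenomena.PercolationContinuityZ3.Theorems.Transplant.HexShadowBlocksR
import Summits.CriticalPhenomena.PercolationContinuityZ3.Theorems.Transplant.HexShadowFact2ReductionR
import Summits.CriticalPhenomena.PercolationContinuityZ3.Theorems.Transplant.HexShadowRoutingNode
import HarnessLib

/-!
# HEXAGONAL SHADOWS LIII — THE ROUTING AT A GENERAL SURGERY RADIUS `R`: `ShapedLinkage R ⇒` located surgeries `⇒ HexGluing`; the film rows modulo `ShapedLinkage R`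

builds on p205010 (kernel theorem, internal audit signed; external expert review pending) — NOT used in this file.  Lane `prim-bschramm`, seat
`prim-bschramm-p2` (gen 39; class C1b; memo `HOME/bschramm/P2-LATTICES.md` §136 (11),(13), §137); helper file (`--supports stmt-CriticalPhenomena-4575 --as helper`).
«HexShadowVRouting» §2 and «HexShadowVLinkageNode» §1 VERBATIM with DST's surgery radius a parameter `R ≥ 1` (blocks `DblkR R`/`RPblkR R` and exceptional sets
`X₁R R`, `X₂R R`, `zBadR R` of «HexShadowBlocksR»; scale `m ≥ 2R + 1`; located outputs `SurgOutR Γ R` of «HexShadowSurgOutR»; Fact 2 by «HexShadowFact2ReductionR»):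
* §1 **`exists_vsurgery_of_shapedLinkageR`** — for `ω ∈ 𝒳` and a point `z ∈ U(ω)` off `X₁R ∪ X₂R ∪ zBadR` and not within `R` of the end of `γ_min(ω)`, a vertex-set
  surgery with `W ⊆ \overline{hexBall z R}` (the instance's cleared set for the block pair `(RPblkR R z, DblkR R z)`, the certified `Terminals R`, the keyed routing);
* §2 **`locatedSurgeriesR_of_shapedLinkage`** — `SurgOutR Γ R` outputs at all but `N₀(R) = 2(2R+1)² + (2R+3)² + 2(8R+1)²` points of `U(ω)` (`m ≥ 2R+1`), hence
  **`hexGluing_of_shapedLinkageR`**, **`slab111OwnCriticalContinuity_of_shapedLinkageR`** (every `k ≥ 1`, every `R ≥ 1`) and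
  **`TriFilm.theta_criticalProb_eq_zero_of_shapedLinkageR`**.  (For `R = 3` this is the route of «HexShadowVLinkageNode»; `R = 4` is what the `(111)`-film of
  thickness `3` needs, «Slab111SK4FinalK3».)
[cite: DuminilCopinSidoraviciusTassion2016, §2.3 (proof of Fact 2, pp. 6–7: "fix R", u', v', w', the three paths)] [cite: NewmanTassionWu2017, §3.2 (Def. 3.7, proof of Thm. 3.9)]
-/

noncomputable section

namespace Summit.CriticalPhenomena.PercolationContinuityZ3.Theorems.Transplant

open MeasureTheory Literature.Probability.Percolation Literature.Probability.LatticeModels SimpleGraph Filter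
open scoped Classical Topology

namespace HexShadow

variable {V : Type} {G : SimpleGraph V} {Φ : HexShadow G} [Countable V]

/-! ## §1 The surgery at a good point of `U(ω)`, surgery radius `R` -/

/-- **THE VERTEX-SET SURGERY OF RADIUS `R` EXISTS AT EVERY GOOD POINT OF `U(ω)`, given `ShapedLinkage R`** (DST 2016, §2.3, proof of Fact 2: the construction of
`ω^{(z)}` with the ball `\overline{B_R(z)}`, as the data `HexShadow.VSurgery` with cleared vertices `W ⊆ \overline{hexBall z R}`).  `W` is the instance's cleared set for
the block pair `(RPblkR R z, DblkR R z)`; `E₁, E₂` are the first and last visits of `γ_min` to `W`; the terminal data `Terminals R` is certified from `γ_min` and the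
`(P2)`-witness exactly as at radius `3`; the keyed routing comes from the swap pair. [cite: DuminilCopinSidoraviciusTassion2016, §2.3, proof of Fact 2 (pp. 6–7)] -/
theorem exists_vsurgery_of_shapedLinkageR {R : ℕ} (hL : Φ.ShapedLinkage R) (hR : 1 ≤ R) {Γ : GlueData} (hΓ : Φ.InRange Γ) (hm : 2 * R + 1 ≤ Γ.m)
    {ω : BondConfig V} (hω : ω ⊆ G.edgeSet) (hX : ω ∈ Φ.evX Γ) {z : Site 2} (hz : z ∈ Φ.U Γ ω) (hX₁ : z ∉ Φ.X₁R R Γ) (hX₂ : z ∉ Φ.X₂R R Γ)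
    (hzb : z ∉ Φ.zBadR R Γ) (hfar : ∀ v ∈ (Φ.γmin Γ ω).getLast?, z ∉ hexBall (Φ.sh v) R) :
    ∃ sg : Φ.VSurgery Γ ω, sg.W ⊆ Φ.lift (hexBall z R) := by
  have hA : ω ∈ Φ.evA Γ := hX.1.1.1
  obtain ⟨hγO, -⟩ := Φ.γmin_spec Γ hA
  have hzU := hz
  obtain ⟨hzs, ⟨g, hgγ, hgz⟩, -⟩ := hz
  have hzbig : z ∈ Φ.big Γ := by rw [← hgz]; exact hγO.subset g hgγ
  have hadj : ∀ {a b : V}, s(a, b) ∈ ω → G.Adj a b := fun h => (SimpleGraph.mem_edgeSet G).1 (hω h)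
  -- the instance's cleared set for the block pair `(RP(z), D(z))` of radius `R`
  obtain ⟨htRD, hsRD⟩ := tRR_le_tD (Φ := Φ) R Γ z
  obtain ⟨W, hWblk, hWin, hWlink⟩ := Φ.exists_W_of_shapedLinkage hL z htRD hsRD (le_tRR_or_sR hX₂)
  have hWD : ∀ x ∈ W, Φ.sh x ∈ Φ.DblkR R Γ z := hWblk
  have hWR : W ⊆ Φ.lift (hexBall z R) := fun x hx => by rw [mem_lift]; exact Φ.DblkR_subset_hexBall R Γ z (hWD x hx)
  have hWwin : W ⊆ Φ.lift (Φ.big Γ ∪ Φ.small Γ) := fun x hx => by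
    rw [mem_lift]; exact DblkR_subset_window hΓ hm hzbig hzs hX₁ (hWD x hx)
  have hWbig : ∀ x : V, Φ.sh x ∈ hexBall z 1 → Φ.sh x ∈ Φ.big Γ → x ∈ W := fun x h1 hb =>
    hWin x h1 (Φ.hexBall_inter_big_subset_DblkR Γ z (hexBall_mono z hR h1) hb)
  have hWsmall : ∀ x : V, Φ.sh x ∈ hexBall z 1 → Φ.sh x ∈ Φ.small Γ → x ∈ W := fun x h1 hs =>
    hWin x h1 (Φ.hexBall_inter_small_subset_DblkR Γ z (hexBall_mono z hR h1) hs)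
  -- a vertex adjacent to a vertex over `z`, over `big`, lies in `W`
  have hnbW : ∀ {a b : V}, Φ.sh a = z → G.Adj a b → Φ.sh b ∈ Φ.big Γ → b ∈ W := by
    intro a b ha hab hb
    refine hWbig b ?_ hb
    have hlip := Φ.lip hab
    rw [ha] at hlip
    exact mem_hexBall_comm.2 (by rw [mem_hexBall]; exact_mod_cast hlip)
  -- `g ∈ W`; the end and the start of `γ` are outside `W`
  have hz1 : z ∈ hexBall z 1 := by rw [mem_hexBall_iff_lin]; omega
  have hgW : g ∈ W := hWbig g (hgz.symm ▸ hz1) (hgz.symm ▸ hzbig)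
  have hlastW : (Φ.γmin Γ ω).getLast hγO.ne_nil ∉ W := by
    intro h
    have := hfar ((Φ.γmin Γ ω).getLast hγO.ne_nil) (by rw [List.getLast?_eq_some_getLast hγO.ne_nil]; rfl)
    have h3 := hWR h
    rw [mem_lift] at h3
    exact this (mem_hexBall_comm.1 h3)
  have hheadW : ∀ h : Φ.γmin Γ ω ≠ [], (Φ.γmin Γ ω).head h ∉ W := by
    intro h hW
    exact DblkR_disjoint_src hΓ hm hzs (hWD _ hW) (hγO.head_mem h)
  have hzZ : z ∉ Φ.zSeg Γ := by
    intro hzZ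
    have hg := Φ.eq_getLast_of_sh_mem_zSeg Γ hA hgγ (hgz.symm ▸ hzZ)
    exact hlastW (hg ▸ hgW)
  -- two distinct vertices of `γ` in `W`: `g` and its successor
  have htwo : ∃ a ∈ Φ.γmin Γ ω, ∃ b ∈ Φ.γmin Γ ω, a ≠ b ∧ a ∈ W ∧ b ∈ W := by
    obtain ⟨l₁, l₂, hsplit⟩ := List.append_of_mem hgγ
    have hl₂ : l₂ ≠ [] := by
      rintro rfl
      have : (Φ.γmin Γ ω).getLast hγO.ne_nil = g := by simp only [hsplit, List.getLast_append_of_ne_nil _ (List.cons_ne_nil _ _), List.getLast_singleton]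
      exact hlastW (this ▸ hgW)
    obtain ⟨u, l₂', rfl⟩ := List.exists_cons_of_ne_nil hl₂
    have hch := hγO.chain
    rw [hsplit, List.isChain_append] at hch
    have hgu : s(g, u) ∈ ω ∧ g ≠ u := (List.isChain_cons_cons.1 hch.2.1).1
    have huγ : u ∈ Φ.γmin Γ ω := by rw [hsplit]; simp
    exact ⟨g, hgγ, u, huγ, hgu.2, hgW, hnbW hgz (hadj hgu.1) (hγO.subset u huγ)⟩
  -- the decomposition at the first and last visits
  obtain ⟨p₀, E₁, mid, E₂, s₀, hγeq, hp₀, hs₀, hp₀W, hs₀W, hE₁W, hE₂W⟩ := Φ.γmin_split_atV Γ hA W hheadW (fun h => hlastW) htwo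
  have hnd := hγO.nodup
  rw [hγeq] at hnd
  have hE₁γ : E₁ ∈ Φ.γmin Γ ω := by rw [hγeq]; simp
  have hE₂γ : E₂ ∈ Φ.γmin Γ ω := by rw [hγeq]; simp
  have hE₁₂ : E₁ ≠ E₂ := by
    intro h
    rw [List.nodup_append] at hnd
    have := (List.nodup_cons.1 hnd.2.1).1
    exact this (by rw [h]; simp)
  -- `E₁`, `E₂` are off `Z_n` (they are not the last vertex)
  have hE₁Z : Φ.sh E₁ ∉ Φ.zSeg Γ := fun hZ => hlastW (Φ.eq_getLast_of_sh_mem_zSeg Γ hA hE₁γ hZ ▸ hE₁W)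
  have hE₂Z : Φ.sh E₂ ∉ Φ.zSeg Γ := fun hZ => hlastW (Φ.eq_getLast_of_sh_mem_zSeg Γ hA hE₂γ hZ ▸ hE₂W)
  have hE₁big : Φ.sh E₁ ∈ Φ.big Γ := hγO.subset E₁ hE₁γ
  have hE₂big : Φ.sh E₂ ∈ Φ.big Γ := hγO.subset E₂ hE₂γ
  have hE₁RP : Φ.sh E₁ ∈ Φ.RPblkR R Γ z := mem_RPblkR_of hzbig hzZ hzb (hWD _ hE₁W) hE₁big hE₁Z
  have hE₂RP : Φ.sh E₂ ∈ Φ.RPblkR R Γ z := mem_RPblkR_of hzbig hzZ hzb (hWD _ hE₂W) hE₂big hE₂Z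
  -- the neighbours of `E₁`, `E₂` along `γ`
  have hch := hγO.chain
  rw [hγeq, List.isChain_append] at hch
  set o₁ := p₀.getLast hp₀ with ho₁
  have ho₁E : s(o₁, E₁) ∈ ω := (hch.2.2 o₁ (by simp [ho₁, List.getLast?_eq_some_getLast hp₀]) E₁ (by simp)).1
  have ho₁p₀ : o₁ ∈ p₀ := List.getLast_mem hp₀
  have ho₁γ : o₁ ∈ Φ.γmin Γ ω := by rw [hγeq]; exact List.mem_append_left _ ho₁p₀
  have ho₁W : o₁ ∉ W := hp₀W _ ho₁p₀
  set o₂ := s₀.head hs₀ with ho₂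
  have h1 := hch.2.1
  rw [List.isChain_cons] at h1
  have h3 := List.isChain_append.1 (show (mid ++ E₂ :: s₀).IsChain _ from h1.2)
  have h4 := h3.2.1
  rw [List.isChain_cons] at h4
  have hE₂o : s(E₂, o₂) ∈ ω := (h4.1 o₂ (by simp [ho₂, List.head?_eq_some_head hs₀])).1
  have ho₂s₀ : o₂ ∈ s₀ := List.head_mem hs₀
  have ho₂γ : o₂ ∈ Φ.γmin Γ ω := by rw [hγeq]; simp [ho₂s₀]
  have ho₂W : o₂ ∉ W := hs₀W _ ho₂s₀
  -- `E₁`, `E₂` are not over `z` (their outer neighbours are outside `W`), so `g ∈ mid` and `mid ≠ []`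
  have hE₁z : Φ.sh E₁ ≠ z := fun h => ho₁W (hnbW h (hadj ho₁E).symm (hγO.subset o₁ ho₁γ))
  have hE₂z : Φ.sh E₂ ≠ z := fun h => ho₂W (hnbW h (hadj hE₂o) (hγO.subset o₂ ho₂γ))
  have hgmid : g ∈ mid := by
    have hg := hgγ
    rw [hγeq] at hg
    rcases List.mem_append.1 hg with h | h
    · exact absurd hgW (hp₀W g h)
    rcases List.mem_cons.1 h with h | h
    · exact absurd (h ▸ hgz) hE₁z
    rcases List.mem_append.1 h with h | h
    · exact h
    rcases List.mem_cons.1 h with h | h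
    · exact absurd (h ▸ hgz) hE₂z
    · exact absurd hgW (hs₀W g h)
  have hmid : mid ≠ [] := List.ne_nil_of_mem hgmid
  set a₁ := mid.head hmid with ha₁
  set a₂ := mid.getLast hmid with ha₂
  have ha₁mid : a₁ ∈ mid := List.head_mem hmid
  have ha₂mid : a₂ ∈ mid := List.getLast_mem hmid
  have ha₁γ : a₁ ∈ Φ.γmin Γ ω := by rw [hγeq]; simp [ha₁mid]
  have ha₂γ : a₂ ∈ Φ.γmin Γ ω := by rw [hγeq]; simp [ha₂mid]
  have hE₁a : s(E₁, a₁) ∈ ω := (h1.1 a₁ (by rw [ha₁, List.head?_append, List.head?_eq_some_head hmid]; rfl)).1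
  have ha₂E : s(a₂, E₂) ∈ ω := (h3.2.2 a₂ (by rw [ha₂, List.getLast?_eq_some_getLast hmid]; rfl) E₂ (by simp)).1
  -- distinctness along the self-avoiding `γ = p₀ ++ E₁ :: (mid ++ E₂ :: s₀)`
  have hnd' := hnd
  rw [List.nodup_append] at hnd'
  obtain ⟨hp₀nd, hrestnd, hdisj⟩ := hnd'
  have hrest2 := (List.nodup_cons.1 hrestnd).2
  rw [List.nodup_append] at hrest2
  obtain ⟨hmidnd, hE₂s₀nd, hdisj2⟩ := hrest2
  have hE₁notin := (List.nodup_cons.1 hrestnd).1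
  have ha₁o₁ : a₁ ≠ o₁ := fun h => hdisj o₁ ho₁p₀ a₁ (by simp [ha₁mid]) h.symm
  have ha₁E₂ : a₁ ≠ E₂ := fun h => hdisj2 a₁ ha₁mid E₂ (by simp) h
  have ha₂o₂ : a₂ ≠ o₂ := fun h => hdisj2 a₂ ha₂mid o₂ (by simp [ho₂s₀]) h
  have ha₂E₁ : a₂ ≠ E₁ := fun h => hE₁notin (by rw [← h]; exact List.mem_append_left _ ha₂mid)
  have ho₁o₂ : o₁ ≠ o₂ := fun h => hdisj o₁ ho₁p₀ o₂ (by simp [ho₂s₀]) h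
  have ho₁a₂ : o₁ ≠ a₂ := fun h => hdisj o₁ ho₁p₀ a₂ (by simp [ha₂mid]) h
  have ha₁o₂ : a₁ ≠ o₂ := fun h => hdisj2 a₁ ha₁mid o₂ (by simp [ho₂s₀]) h
  have ha₁a₂ : a₁ = a₂ → Φ.sh a₁ = z := by
    intro h
    -- `mid` is duplicate-free with `head = last`, so `mid = [a₁]` and `g = a₁`
    obtain ⟨x, xs, hx⟩ := List.exists_cons_of_ne_nil hmid
    have hxs : xs = [] := by
      by_contra hne
      have hl : mid.getLast hmid = xs.getLast hne := by simp only [hx, List.getLast_cons hne]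
      have hh : mid.head hmid = x := by simp only [hx, List.head_cons]
      have : x ∈ xs := by
        have := List.getLast_mem hne
        rw [← hl, ← ha₂, ← h, ha₁, hh] at this; exact this
      rw [hx] at hmidnd
      exact (List.nodup_cons.1 hmidnd).1 this
    subst hxs
    have hg' : g = x := by rw [hx] at hgmid; simpa using hgmid
    have : a₁ = x := by rw [ha₁]; simp only [hx, List.head_cons]
    rw [this, ← hg']; exact hgz
  -- the `src'`-side path `σ` and `w'`
  obtain ⟨w', σ, hσhead, hw'W, hσchain, hσsmall, hσγ, hσW, hσsrc'⟩ := Φ.exists_sigma_of_mem_UV Γ hzU (W := W) hWsmall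
  have hσne : σ ≠ [] := by rintro rfl; simp at hσhead
  have hw'σ : w' ∈ σ := by
    have : σ.head hσne = w' := by rw [List.head?_eq_some_head hσne, Option.some.injEq] at hσhead; exact hσhead
    rw [← this]; exact List.head_mem _
  have hw'γ : Φ.sh w' ∉ Φ.γcols Γ ω := hσγ w' hw'σ
  have hoff : ∀ {x : V}, x ∈ Φ.γmin Γ ω → Φ.sh w' ≠ Φ.sh x := fun {x} hx h => hw'γ ⟨x, hx, h.symm⟩
  -- the certified terminal data and the routing
  have hT : Φ.Terminals R z (Φ.tRR R Γ z) (Φ.tD Γ z) (Φ.sR Γ z) W E₁ E₂ w' :=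
    { ne := hE₁₂, E₁W := hE₁W, E₂W := hE₂W, E₁R := hE₁RP, E₂R := hE₂RP, E₁z := hE₁z, E₂z := hE₂z, w'W := hw'W,
      w'z := fun h => hw'γ ⟨g, hgγ, hgz.trans h.symm⟩, w'E₁ := hoff hE₁γ, w'E₂ := hoff hE₂γ,
      nbrs := ⟨o₁, a₁, a₂, o₂, hadj ho₁E, hadj hE₁a, hadj ha₂E, hadj hE₂o, ho₁W, ho₂W,
        inWin_of_mem_big hzbig (hγO.subset o₁ ho₁γ), inWin_of_mem_big hzbig (hγO.subset a₁ ha₁γ),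
        inWin_of_mem_big hzbig (hγO.subset a₂ ha₂γ), inWin_of_mem_big hzbig (hγO.subset o₂ ho₂γ),
        ha₁o₁, ha₁E₂, ha₂o₂, ha₂E₁, ho₁o₂, ho₁a₂, ha₁o₂, ha₁a₂, hoff ho₁γ, hoff ha₁γ, hoff ha₂γ, hoff ho₂γ⟩ }
  obtain ⟨r, hkey⟩ := hWlink E₁ E₂ w' hT
  have hRPbig : Φ.RPblkR R Γ z ⊆ Φ.big Γ := RPblkR_subset_big hΓ hm hzbig hzs
  have hPRP : ∀ x ∈ r.P, Φ.sh x ∈ Φ.RPblkR R Γ z := fun x hx => by have := (r.hP x hx).2; rwa [mem_lift] at this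
  refine ⟨⟨W, p₀, E₁, mid, E₂, s₀, r.P, r.c, r.Br, σ, hWwin, hγeq, hp₀, hs₀, hp₀W, hs₀W, hE₁W, hE₂W,
    fun x hx => (r.hP x hx).1, fun x hx => hRPbig (hPRP x hx), fun x hx => RPblkR_disjoint_zSeg hzbig hzZ hzb (hPRP x hx),
    r.hchain, r.hnodup, r.c_mem, r.hBr, r.hBrW, r.hBrchain, r.hBrnodup, r.hBrSP, r.hfwd_of_key hkey, ?_, by rw [r.hBrlast]; exact hσhead,
    hσchain, hσsmall, hσγ, hσW, hσsrc'⟩, hWR⟩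
  -- no structure vertex over `S_{3n}`
  intro v hv hvsrc _
  rw [mem_lift] at hvsrc
  rcases List.mem_append.1 hv with h | h
  · exact absurd hvsrc (DblkR_disjoint_src hΓ hm hzs (hWD v (r.hP v h).1))
  · exact absurd hvsrc (DblkR_disjoint_src hΓ hm hzs (hWD v (r.hBrW v (List.dropLast_subset _ h))))

/-! ## §2 The radius-generic node from shaped linkage; the film rows -/

variable (Φ)

/-- Counting in a filtered finset through a bounded hexagon. [folklore] -/
theorem card_filter_le_of_forall_mem_hexBall (T : Finset (Site 2)) {p : Site 2 → Prop} {q : Site 2} {n : ℕ}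
    (h : ∀ z ∈ T, p z → z ∈ hexBall q n) : (T.filter p).card ≤ (2 * n + 1) ^ 2 := by
  refine (Finset.card_le_card fun z hz => ?_).trans (card_filter_mem_hexBall_le T q n)
  rw [Finset.mem_filter] at hz ⊢
  exact ⟨hz.1, h z hz.1 hz.2⟩

/-- **THE RADIUS-GENERIC ROUTING NODE FROM SHAPED LINKAGE** (DST 2016, §2.3, proof of Fact 2, "fix `R`"): under `ShapedLinkage R` (`R ≥ 1`), located surgery
outputs `SurgOutR Γ R` exist at all but at most `N₀(R) = 2(2R+1)² + (2R+3)² + 2(8R+1)²` points of `U(ω)`, for all data in range with `m ≥ 2R + 1` and every lattice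
configuration `ω ∈ 𝒳` (the excluded points: `X₁R`, `X₂R`, `zBadR`, and the hexagon of radius `R` about the end of `γ_min`).
[cite: DuminilCopinSidoraviciusTassion2016, §2.3 (proof of Fact 2, pp. 6–7)] -/
theorem locatedSurgeriesR_of_shapedLinkage {R : ℕ} (hL : Φ.ShapedLinkage R) (hR : 1 ≤ R) :
    ∃ r N₀ m₀ : ℕ, ∀ Γ : GlueData, m₀ ≤ Γ.m → Φ.InRange Γ → ∀ ω : BondConfig V, ω ⊆ G.edgeSet → ω ∈ Φ.evX Γ →
      ∃ Good : Finset (Site 2), (↑Good : Set (Site 2)) ⊆ Φ.U Γ ω ∧ (Φ.U Γ ω).ncard ≤ Good.card + N₀ ∧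
        ∀ z ∈ Good, ∃ ω' : BondConfig V, Φ.SurgOutR Γ r ω z ω' := by
  refine ⟨R, (2 * R + 1) ^ 2 + (2 * (R + 1) + 1) ^ 2 + ((2 * (4 * R) + 1) ^ 2 + (2 * (4 * R) + 1) ^ 2) + (2 * R + 1) ^ 2, 2 * R + 1,
    fun Γ hm hΓ ω hω hX => ?_⟩
  have hA : ω ∈ Φ.evA Γ := hX.1.1.1
  obtain ⟨hγO, -⟩ := Φ.γmin_spec Γ hA
  set v₀ : V := (Φ.γmin Γ ω).getLast hγO.ne_nil with hv₀
  have hlast : (Φ.γmin Γ ω).getLast? = some v₀ := List.getLast?_eq_some_getLast hγO.ne_nil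
  set T : Finset (Site 2) := (Φ.U_finite Γ ω).toFinset with hT
  have hTU : ∀ z, z ∈ T ↔ z ∈ Φ.U Γ ω := fun z => Set.Finite.mem_toFinset _
  set good : Site 2 → Prop := fun z => z ∉ Φ.X₁R R Γ ∧ z ∉ Φ.X₂R R Γ ∧ z ∉ Φ.zBadR R Γ ∧ ∀ v ∈ (Φ.γmin Γ ω).getLast?, z ∉ hexBall (Φ.sh v) R
    with hgood
  have hbs : ∀ z ∈ T, z ∈ Φ.big Γ ∧ z ∈ Φ.small Γ := by
    intro z hz
    obtain ⟨hzs, ⟨g, hg, hgz⟩, -⟩ := (hTU z).1 hz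
    exact ⟨hgz ▸ hγO.subset g hg, hzs⟩
  refine ⟨T.filter good, fun z hz => (hTU z).1 (Finset.mem_filter.1 hz).1, ?_, ?_⟩
  · -- counting the excluded points
    rw [Set.ncard_eq_toFinset_card _ (Φ.U_finite Γ ω), ← Finset.card_filter_add_card_filter_not good]
    change (T.filter good).card + (T.filter fun z => ¬good z).card ≤ (T.filter good).card + _
    have hsub : (T.filter fun z => ¬good z) ⊆ T.filter (· ∈ Φ.X₁R R Γ) ∪ T.filter (· ∈ Φ.X₂R R Γ) ∪
        (T.filter (· ∈ hexBall (Φ.centre + ![6 * (Γ.m : ℤ), Φ.period * Γ.s - Γ.m - Γ.a]) (4 * R)) ∪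
          T.filter (· ∈ hexBall (Φ.centre + ![6 * (Γ.m : ℤ), Φ.period * Γ.s - Γ.m + Γ.a]) (4 * R))) ∪ T.filter (· ∈ hexBall (Φ.sh v₀) R) := by
      intro z hz
      rw [Finset.mem_filter] at hz
      obtain ⟨hzT, hng⟩ := hz
      simp only [hgood, not_and_or, not_not, not_forall, exists_prop] at hng
      simp only [Finset.mem_union, Finset.mem_filter]
      rcases hng with h | h | h | ⟨v, hv, h⟩
      · exact Or.inl (Or.inl (Or.inl ⟨hzT, h⟩))
      · exact Or.inl (Or.inl (Or.inr ⟨hzT, h⟩))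
      · rcases zBadR_subset h with h' | h'
        · exact Or.inl (Or.inr (Or.inl ⟨hzT, h'⟩))
        · exact Or.inl (Or.inr (Or.inr ⟨hzT, h'⟩))
      · right
        rw [hlast] at hv
        simp only [Option.mem_def, Option.some.injEq] at hv
        subst hv
        exact ⟨hzT, h⟩
    have h1 : (T.filter (· ∈ Φ.X₁R R Γ)).card ≤ (2 * R + 1) ^ 2 :=
      card_filter_le_of_forall_mem_hexBall T fun z hz hX => X₁R_subset hX (hbs z hz).1 (hbs z hz).2
    have h2 : (T.filter (· ∈ Φ.X₂R R Γ)).card ≤ (2 * (R + 1) + 1) ^ 2 :=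
      card_filter_le_of_forall_mem_hexBall T fun z hz hX => X₂R_subset hX (hbs z hz).1
    have h3 : (T.filter (· ∈ hexBall (Φ.centre + ![6 * (Γ.m : ℤ), Φ.period * Γ.s - Γ.m - Γ.a]) (4 * R))).card ≤ (2 * (4 * R) + 1) ^ 2 :=
      card_filter_le_of_forall_mem_hexBall T fun z _ h => h
    have h4 : (T.filter (· ∈ hexBall (Φ.centre + ![6 * (Γ.m : ℤ), Φ.period * Γ.s - Γ.m + Γ.a]) (4 * R))).card ≤ (2 * (4 * R) + 1) ^ 2 :=
      card_filter_le_of_forall_mem_hexBall T fun z _ h => h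
    have h5 : (T.filter (· ∈ hexBall (Φ.sh v₀) R)).card ≤ (2 * R + 1) ^ 2 := card_filter_le_of_forall_mem_hexBall T fun z _ h => h
    have := (Finset.card_le_card hsub).trans ((Finset.card_union_le _ _).trans (add_le_add ((Finset.card_union_le _ _).trans (add_le_add
      ((Finset.card_union_le _ _).trans (add_le_add h1 h2)) ((Finset.card_union_le _ _).trans (add_le_add h3 h4)))) h5))
    omega
  · -- the surgery at a good point
    intro z hz
    obtain ⟨hzT, hg⟩ := Finset.mem_filter.1 hz
    obtain ⟨sg, hsg⟩ := exists_vsurgery_of_shapedLinkageR hL hR hΓ hm hω hX ((hTU z).1 hzT) hg.1 hg.2.1 hg.2.2.1 hg.2.2.2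
    exact ⟨sg.newConfig, sg.surgOutR hX hsg⟩

/-- **THE HEXAGONAL GLUING LEMMA FROM SHAPED LINKAGE OF ANY RADIUS `R ≥ 1`.** [cite: DuminilCopinSidoraviciusTassion2016, Lemma 6 and §2.3] -/
theorem hexGluing_of_shapedLinkageR {R : ℕ} (hL : Φ.ShapedLinkage R) (hR : 1 ≤ R) : Φ.HexGluing :=
  Φ.hexGluing_of_locatedSurgeriesR (Φ.locatedSurgeriesR_of_shapedLinkage hL hR)

end HexShadow

/-- **THE `(111)`-FILM THEOREM MODULO SHAPED LINKAGE OF ANY RADIUS**: for every `k ≥ 1` and `R ≥ 1`, `ShapedLinkage R` for the shadow of `F_k = {0 ≤ x₀+x₁+x₂ ≤ k}`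
gives `Slab111OwnCriticalContinuity k`.  Independent of p205010. [cite: DuminilCopinSidoraviciusTassion2016, Thm. 1, §2.3] [cite: BenjaminiSchramm1996, Conj. 4 / Question 3] -/
theorem slab111OwnCriticalContinuity_of_shapedLinkageR {k R : ℕ} (hk : 1 ≤ k) (hR : 1 ≤ R) (h : (Slab111.hexShadow k).ShapedLinkage R) :
    Slab111OwnCriticalContinuity k :=
  slab111OwnCriticalContinuity_of_hexGluing hk ((Slab111.hexShadow k).hexGluing_of_shapedLinkageR h hR)

/-- **THE TRIANGULAR FILMS MODULO SHAPED LINKAGE OF ANY RADIUS**: for every `k` and `R ≥ 1`, `ShapedLinkage R` for the shadow of `𝕋 × {0..k}` gives `θ_v(p_c) = 0`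
at every vertex. [cite: DuminilCopinSidoraviciusTassion2016, Thm. 1, §2.3] [cite: BenjaminiSchramm1996, Conj. 4 / Question 3] -/
theorem TriFilm.theta_criticalProb_eq_zero_of_shapedLinkageR (k : ℕ) {R : ℕ} (hR : 1 ≤ R) (h : (TriFilm.hexShadow k).ShapedLinkage R) (v : triFilm k) :
    theta (TriFilm.film k) v (criticalProbIOf (TriFilm.film k) v) = 0 :=
  TriFilm.theta_criticalProb_eq_zero_of_hexGluing' k ((TriFilm.hexShadow k).hexGluing_of_shapedLinkageR h hR) v

end Summit.CriticalPhenomena.PercolationContinuityZ3.Theorems.Transplant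

end
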